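import Literature.AlgebraicGeometry.Resolution.KummerToricAlgebraLocal
import Mathlib.Algebra.CharP.Reduced
import Mathlib.Algebra.CharP.Algebra
import HarnessLib

/-!
# The Kummer toric algebra embeds into any field containing a `p`-th root of `x^c`

Topic: `Literature/AlgebraicGeometry/Resolution`. Sequel to `KummerToricAlgebra.lean` /
`KummerToricAlgebraLocal.lean`. For a domain `O` of characteristic `p`, elements `x_j ≠ 0`,
exponents `c` (with `c_{j₀} = 1` in the applications) and a field `K ⊇ O` containing `τ` with
`τ^p = x^c`, the toric algebra `T` of the normalised Kummer cover (the `O`-span of the Kummer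
monomials `s^n`, `n̄ ∈ 𝔽_p c̄`, inside the root cover `O[s]/(s^p - x)`, assumed a domain)
EMBEDS into `K` over `O` by

  `ψ(s^n) = τ^{n_{j₀}} / x^{⌊n_{j₀} c / p⌋}`   (`exists_algHom_toric`).

Multiplicativity is checked on `p`-th powers — `ψ(s^n)^p = x^n` (`psi0_pow`) and Frobenius is
injective on `K` — and injectivity by incomparability of primes in the integral extension
`O ⊆ T`. With `K = Frac(O[t]/(t^p - a))` at a Kummer point `a = g^p + v x^A` this identifies
`T` with the integral closure of the model (K. Kato, *Toric singularities*, Amer. J. Math. 116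
(1994), (2.2)(2): the normalised Kummer cover along an snc boundary is the toric local model),
the image being an integrally closed domain integral over `O` containing `t`
(Theorems side of the crux `PicoverLocalModel`).

* `RootCover.IsKummerExp.val_eq_mod`, `kummerMonomial_mul`, `algebraMap_prod_pow_ne_zero`,
  `psi0_pow`, `exists_algHom_toric`.

Sources: [Kato1994] K. Kato, Amer. J. Math. 116 (1994), (2.2)(2), Thm. (4.1).
-/

noncomputable section

namespace Literature.AlgebraicGeometry.Resolution

open MvPolynomial

namespace RootCover

variable {O : Type*} [CommRing O] {r : ℕ} {p : ℕ} [hp : Fact p.Prime] {x : Fin r → O}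
variable {j₀ : Fin r} {c : Fin r → ℕ}

omit hp in
/-- For a Kummer exponent `n`, `n_j = (n_{j₀} c_j) mod p`. [folklore] -/
theorem IsKummerExp.val_eq_mod {n : Fin r → Fin p} (hn : IsKummerExp p j₀ c n)
    (j : Fin r) : (n j : ℕ) = (n j₀ : ℕ) * c j % p := by
  have h := hn j
  rw [← Nat.cast_mul, ZMod.natCast_eq_natCast_iff', Nat.mod_eq_of_lt (n j).2] at h
  rw [h, mul_comm]

/-- The Kummer monomials multiply by the table of the box monomials. [folklore] -/
theorem kummerMonomial_mul (n m : {n : Fin r → Fin p // IsKummerExp p j₀ c n}) :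
    kummerMonomial p x j₀ c n * kummerMonomial p x j₀ c m =
      carry x n.1 m.1 • kummerMonomial p x j₀ c ⟨addBox n.1 m.1, isKummerExp_addBox n.2 m.2⟩ :=
  Subtype.ext (by
    rw [Subalgebra.coe_mul, coe_kummerMonomial, coe_kummerMonomial, boxMonomial_mul,
      Subalgebra.coe_smul, coe_kummerMonomial])

section Embedding

variable [IsDomain O] {K : Type*} [Field K] [Algebra O K]

/-- Images of monomials in the `x_j` are non-zero in `K`. [folklore] -/
theorem algebraMap_prod_pow_ne_zero (hx0 : ∀ j, x j ≠ 0)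
    (hinj : Function.Injective (algebraMap O K)) (k : Fin r → ℕ) :
    algebraMap O K (∏ j, x j ^ k j) ≠ 0 :=
  (map_ne_zero_iff _ hinj).mpr (Finset.prod_ne_zero_iff.mpr fun j _ => pow_ne_zero _ (hx0 j))

omit hp in
/-- The `p`-th power of the would-be image `τ^{n_{j₀}} / x^{⌊n_{j₀} c / p⌋}` of the Kummer
monomial `s^n` is `x^n`. [cite: Kato1994, (2.2)(2)] -/
theorem psi0_pow (hx0 : ∀ j, x j ≠ 0) (hinj : Function.Injective (algebraMap O K)) (τ : K)
    (hτ : τ ^ p = algebraMap O K (∏ j, x j ^ c j))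
    (n : {n : Fin r → Fin p // IsKummerExp p j₀ c n}) :
    (τ ^ (n.1 j₀ : ℕ) / algebraMap O K (∏ j, x j ^ ((n.1 j₀ : ℕ) * c j / p))) ^ p =
      algebraMap O K (∏ j, x j ^ (n.1 j : ℕ)) := by
  have hden := algebraMap_prod_pow_ne_zero hx0 hinj (fun j => (n.1 j₀ : ℕ) * c j / p)
  rw [div_pow, div_eq_iff (pow_ne_zero _ hden), ← pow_mul, mul_comm (n.1 j₀ : ℕ) p, pow_mul, hτ,
    ← map_pow, ← map_pow, ← map_mul, ← Finset.prod_pow, ← Finset.prod_pow,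
    ← Finset.prod_mul_distrib]
  congr 1
  refine Finset.prod_congr rfl fun j _ => ?_
  rw [← pow_mul, ← pow_mul, ← pow_add, IsKummerExp.val_eq_mod n.2 j, mul_comm (c j),
    Nat.mod_add_div']

/-- **The embedding of the toric algebra into a field containing a `p`-th root `τ` of `x^c`.**
For a domain `O` of characteristic `p` with `x_j ≠ 0`, `c_{j₀} = 1`, a field `K ⊇ O` and
`τ ∈ K` with `τ^p = x^c`, there is an injective `O`-algebra map `ψ : T → K` from the toric
algebra of the Kummer cover (assumed a domain through its root cover) with
`ψ(s^n) = τ^{n_{j₀}} / x^{⌊n_{j₀} c/p⌋}` on Kummer monomials. Multiplicativity is checked on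
`p`-th powers (`ψ(s^n)^p = x^n`, Frobenius being injective on `K`); injectivity by
incomparability (`T` is integral over `O` and `ker ψ ∩ O = 0`). [cite: Kato1994, (2.2)(2)] -/
theorem exists_algHom_toric [CharP O p] (hx0 : ∀ j, x j ≠ 0)
    (hinj : Function.Injective (algebraMap O K)) (τ : K)
    (hτ : τ ^ p = algebraMap O K (∏ j, x j ^ c j)) [IsDomain (RootCover p x)] :
    ∃ ψ : toric p x j₀ c →ₐ[O] K, Function.Injective ψ ∧
      ∀ n : {n : Fin r → Fin p // IsKummerExp p j₀ c n},
        ψ (kummerMonomial p x j₀ c n) =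
          τ ^ (n.1 j₀ : ℕ) / algebraMap O K (∏ j, x j ^ ((n.1 j₀ : ℕ) * c j / p)) := by
  classical
  haveI : CharP K p := charP_of_injective_algebraMap hinj p
  haveI : ExpChar K p := ExpChar.prime hp.out
  -- the linear map
  let ψ₀ : {n : Fin r → Fin p // IsKummerExp p j₀ c n} → K := fun n =>
    τ ^ (n.1 j₀ : ℕ) / algebraMap O K (∏ j, x j ^ ((n.1 j₀ : ℕ) * c j / p))
  have hψ₀ : ∀ n, ψ₀ n ^ p = algebraMap O K (∏ j, x j ^ (n.1 j : ℕ)) :=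
    fun n => psi0_pow hx0 hinj τ hτ n
  let L : toric p x j₀ c →ₗ[O] K := (toricBasis p x j₀ c).constr O ψ₀
  have hL : ∀ n, L (kummerMonomial p x j₀ c n) = ψ₀ n := fun n => by
    rw [← toricBasis_apply]; exact (toricBasis p x j₀ c).constr_basis O ψ₀ n
  -- `L 1 = 1`
  have h1 : L 1 = 1 := by
    rw [← kummerMonomial_zero, hL]
    simp [ψ₀]
  -- multiplicativity on the basis, via `p`-th powers
  have hmul_basis : ∀ n m : {n : Fin r → Fin p // IsKummerExp p j₀ c n},
      L (kummerMonomial p x j₀ c n * kummerMonomial p x j₀ c m) =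
        L (kummerMonomial p x j₀ c n) * L (kummerMonomial p x j₀ c m) := by
    intro n m
    rw [kummerMonomial_mul, map_smul, hL, hL, hL, Algebra.smul_def]
    apply frobenius_inj K p
    rw [frobenius_def, frobenius_def, mul_pow, mul_pow, hψ₀, hψ₀, hψ₀, ← map_pow, ← map_mul,
      ← map_mul]
    congr 1
    rw [carry, ← Finset.prod_pow, ← Finset.prod_mul_distrib, ← Finset.prod_mul_distrib]
    refine Finset.prod_congr rfl fun j _ => ?_
    rw [← pow_mul, ← pow_add, ← pow_add]
    congr 1
    simp only [addBox, Fin.val_mk]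
    rw [mul_comm, Nat.div_add_mod]
  have hmul : ∀ a b : toric p x j₀ c, L (a * b) = L a * L b := by
    intro a b
    have key : (LinearMap.mul O (toric p x j₀ c)).compr₂ L =
        (LinearMap.mul O K).compl₁₂ L L := by
      refine (toricBasis p x j₀ c).ext fun n => (toricBasis p x j₀ c).ext fun m => ?_
      simp only [LinearMap.compr₂_apply, LinearMap.compl₁₂_apply, LinearMap.mul_apply',
        toricBasis_apply]
      exact hmul_basis n m
    have := congrArg (fun f => f a b) key
    simpa using this
  let ψ : toric p x j₀ c →ₐ[O] K := AlgHom.ofLinearMap L h1 hmul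
  refine ⟨ψ, ?_, fun n => hL n⟩
  -- injectivity: the kernel is a prime lying over `0`
  haveI : IsDomain (toric p x j₀ c) := Subalgebra.isDomain _
  haveI : Algebra.IsIntegral O (toric p x j₀ c) := inferInstance
  rw [RingHom.injective_iff_ker_eq_bot]
  haveI : (RingHom.ker ψ).IsPrime := RingHom.ker_isPrime _
  refine Ideal.eq_bot_of_comap_eq_bot (R := O) ?_
  refine eq_bot_iff.mpr fun a ha => ?_
  rw [Ideal.mem_comap, RingHom.mem_ker] at ha
  have ha' : algebraMap O K a = 0 := by rwa [← ψ.commutes a]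
  exact (map_eq_zero_iff _ hinj).mp ha'

end Embedding

end RootCover

end Literature.AlgebraicGeometry.Resolution

end
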